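import Summits.ABC.ABC.Theses.DefiniteXi
import Summits.ABC.ABC.Statement
import Literature.NumberTheory.EllipticCurves.CongruenceNumber
import Literature.NumberTheory.EllipticCurves.CongruenceNumberLevelBoundExplicitProofs
import Literature.NumberTheory.EllipticCurves.PastenSpectralDegreeProofs
import Literature.NumberTheory.EllipticCurves.PastenCongruenceModulusProofs
import Literature.NumberTheory.EllipticCurves.ModularDegreeMinimal
import Literature.NumberTheory.EllipticCurves.ModularCurveManinSemistableBridgeProofs
import Literature.NumberTheory.EllipticCurves.SzpiroFreyConductorProofs
import Literature.NumberTheory.EllipticCurves.RationalIsogenyDegrees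
import Literature.NumberTheory.Automorphic.ShimuraCurveRibetTakahashi
import HarnessLib

/-!
# STUB-IDEAS k2 · generation 19 (FAMILY 2 — RESHAPE) — `stub_primeToSixDegreeBound` (P6)
# crux `DefiniteXi.SteinbergCore` (stmt-ABC-15024), line `p6_tamagawa_split` (sha cda023e8)

Companion of `STUB-IDEAS-stub_primeToSixDegreeBound-2.md` (gen 19).  CHANGE OF CURRENCY `deg_min ↦ r_f`
coordinated with the stub-1 ideator's kernel certificate (k1 g11/g15: `XiCongruenceComparison` PROVED,
`steinbergCore_of_congruenceSplit` PROVED): the P6-side package that a congruence-currency split of the crux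
needs, typed over tree declarations and — except P2 — PROVED modulo NAMED inputs.

* `CongruenceNumberBound` = k1 g11 child 2♮ verbatim (= k2 g5 `CpsCongruenceBound`, `cps` unfolded).
* Q1 `congruenceNumberBound_iff_datum` (PROVED): the newform binder is a dummy — under `FreyModularity` the
  statement is the same over data `D` (`IsNewformOf.unique`); there is no minimality guard to twist.
* P4 `congruenceNumberBound_false_without_eps_pos` (PROVED): the `0 < ε` guard stays load-bearing in the new
  currency (port of p163062: `ε = −3`, `1 ≤ cps r_f`, conductors unbounded — the last taken as the hypothesis
  `hUnb`, discharged BY NAME by `Summit.ABC.ABC.Theorems.FreyDegreeBound.Negative.conductorNorm_freyCurve_unbounded`,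
  whose module is unbuilt on this session's farm snapshot (rc 75 `remote:stale:440:unbuilt`): cited, not imported).
* P1′ `congruenceNumberBound_of_freyDegreeBound` (PROVED from ONE-SIDED ARS `OneSidedARS`, k1 g15 H5): H0 in the
  new currency.  P1 `congruenceNumberBound_of_stub` (PROVED from H5 + `FreyModularity`).  P3
  `stub_of_congruenceNumberBound` (PROVED from Ribet `m ∣ r` + the optimal/Kenku transport; = k2 g5 H8a).
  P2 `congruenceNumberBound_of_ABC_of_facts` (statement; = P1′ ∘ G4 of the P6Ladder helper, not importable).
The one-sided `L6′` chain (`primeToSix_congruenceNumber_le_primeToSix_deg_of_oneSided` and its arithmetic) is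
COPIED from k1 g15 `StubIdeasK1G15` (crux work-files are not importable); `exists_optimalDatum` from k2 g5.
-/

set_option linter.dupNamespace false
set_option autoImplicit false

noncomputable section

namespace Summit.ABC.ABC.Cruxes.SteinbergCore.StubIdeas2G19

open Literature.NumberTheory.EllipticCurves Literature.NumberTheory.EllipticCurves.ModularForms
open Literature.NumberTheory.Automorphic CongruenceSubgroup
open scoped MatrixGroups

/-! ## 0 · `cps` arithmetic (copies: k1 g15, k2 g5, p99113) -/

/-- Prime-to-`6` part, as it appears in the stub. -/
def cps (n : ℕ) : ℕ := n / (ordProj[2] n * ordProj[3] n)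

/-- `2^{v₂ n} 3^{v₃ n} ∣ n`. [folklore] -/
theorem ordProj_two_mul_ordProj_three_dvd (n : ℕ) : ordProj[2] n * ordProj[3] n ∣ n :=
  Nat.Coprime.mul_dvd_of_dvd_of_dvd (Nat.Coprime.pow _ _ (by norm_num)) (Nat.ordProj_dvd n 2)
    (Nat.ordProj_dvd n 3)

/-- `cps n ≠ 0` for `n ≠ 0`. [folklore] -/
theorem primeToSix_ne_zero {n : ℕ} (hn : n ≠ 0) : n / (ordProj[2] n * ordProj[3] n) ≠ 0 :=
  (Nat.div_pos (Nat.le_of_dvd (Nat.pos_of_ne_zero hn) (ordProj_two_mul_ordProj_three_dvd n))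
    (Nat.pos_of_ne_zero (mul_ne_zero (pow_ne_zero _ two_ne_zero) (pow_ne_zero _ three_ne_zero)))).ne'

/-- `1 ≤ cps n` for `n ≠ 0` (the `←` half of `SteinbergCore.Negative.one_le_primeToSix_iff`, p99113). [folklore] -/
theorem one_le_primeToSix_of_ne_zero {n : ℕ} (hn : n ≠ 0) : 1 ≤ n / (ordProj[2] n * ordProj[3] n) :=
  Nat.one_le_iff_ne_zero.mpr (primeToSix_ne_zero hn)

/-- Valuations of `cps n`. [folklore] -/
theorem factorization_primeToSix (n q : ℕ) :
    (n / (ordProj[2] n * ordProj[3] n)).factorization q =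
      if q = 2 ∨ q = 3 then 0 else n.factorization q := by
  rw [Nat.factorization_div (ordProj_two_mul_ordProj_three_dvd n), Finsupp.tsub_apply,
    Nat.factorization_mul (pow_ne_zero _ two_ne_zero) (pow_ne_zero _ three_ne_zero),
    Finsupp.add_apply, Nat.prime_two.factorization_pow, Nat.prime_three.factorization_pow,
    Finsupp.single_apply, Finsupp.single_apply]
  by_cases h2 : q = 2
  · subst h2; simp
  · by_cases h3 : q = 3
    · subst h3; simp
    · simp [h2, h3, Ne.symm h2, Ne.symm h3]

/-- `v_p x ≤ v_p r + v_p e` for all primes `p ≥ 5` gives `cps x ≤ cps r · e`. [folklore] -/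
theorem primeToSix_le_mul_of_factorization_le {x r e : ℕ} (hr : r ≠ 0) (he : e ≠ 0)
    (h : ∀ p : ℕ, p.Prime → 5 ≤ p → x.factorization p ≤ r.factorization p + e.factorization p) :
    x / (ordProj[2] x * ordProj[3] x) ≤ r / (ordProj[2] r * ordProj[3] r) * e := by
  rcases eq_or_ne x 0 with rfl | hx
  · simp
  have hcx := primeToSix_ne_zero hx
  have hcre : r / (ordProj[2] r * ordProj[3] r) * e ≠ 0 := mul_ne_zero (primeToSix_ne_zero hr) he
  refine Nat.le_of_dvd (Nat.pos_of_ne_zero hcre) ((Nat.factorization_le_iff_dvd hcx hcre).mp ?_)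
  rw [Nat.factorization_mul (primeToSix_ne_zero hr) he]
  refine Finsupp.le_def.mpr fun q => ?_
  rw [Finsupp.add_apply, factorization_primeToSix, factorization_primeToSix]
  by_cases h23 : q = 2 ∨ q = 3
  · simp [h23]
  · rw [if_neg h23, if_neg h23]
    by_cases hq : q.Prime
    · have h4 : q ≠ 4 := by rintro rfl; exact absurd hq (by decide)
      have h2q := hq.two_le
      push Not at h23
      exact h q hq (by omega)
    · simp [Nat.factorization_eq_zero_of_not_prime _ hq]

/-- `cps m ≤ cps n` for `m ∣ n ≠ 0`. [folklore] -/
theorem primeToSix_le_of_dvd' {m n : ℕ} (h : m ∣ n) (hn : n ≠ 0) :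
    m / (ordProj[2] m * ordProj[3] m) ≤ n / (ordProj[2] n * ordProj[3] n) := by
  have hm : m ≠ 0 := ne_zero_of_dvd_ne_zero hn h
  have hle := Finsupp.le_def.mp ((Nat.factorization_le_iff_dvd hm hn).mpr h)
  have := primeToSix_le_mul_of_factorization_le (x := m) hn one_ne_zero
    (fun p _ _ => by simpa using hle p)
  simpa using this

/-- `q² ∤ N(E_(a,b))` at every odd prime `q` (`N ∣ 2⁸ rad(ab(a+b))`, `conductorNorm_freyCurve_dvd_holds`). [folklore] -/
theorem not_sq_dvd_conductorNorm_freyCurve_of_ne_two {a b : ℤ} (hab : IsCoprime a b)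
    (h0 : a * b * (a + b) ≠ 0) {q : ℕ} (hq : q.Prime) (hq2 : q ≠ 2) :
    ¬ q ^ 2 ∣ (freyCurve a b).conductorNorm ℤ := by
  intro hq2N
  have h' : q ^ 2 ∣ 2 ^ 8 * (UniqueFactorizationMonoid.radical (a * b * (a + b))).natAbs :=
    hq2N.trans (conductorNorm_freyCurve_dvd_holds a b hab h0)
  have hcop : Nat.Coprime (q ^ 2) (2 ^ 8) :=
    Nat.Coprime.pow _ _ ((Nat.coprime_primes hq Nat.prime_two).mpr hq2)
  have hr : q ^ 2 ∣ (UniqueFactorizationMonoid.radical (a * b * (a + b))).natAbs :=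
    hcop.dvd_of_dvd_mul_left h'
  have hsq : Squarefree (UniqueFactorizationMonoid.radical (a * b * (a + b))).natAbs :=
    Int.squarefree_natAbs.mpr UniqueFactorizationMonoid.squarefree_radical
  have hu : IsUnit (q : ℕ) := hsq q ((pow_two q) ▸ hr)
  exact hq.ne_one (Nat.isUnit_iff.mp hu)

/-- `r_f ≠ 0` for the newform of a datum (`r_f ∣ ∏_{P ≠ 𝕀_f} η_f(P) > 0`, both PROVED in the tree;
copy of k2 g5 `congruenceNumber_ne_zero_of_datum`). [folklore] -/
theorem congruenceNumber_ne_zero_of_datum {W : WeierstrassCurve ℚ} {N : ℕ} [NeZero N]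
    (D : ModularParametrizationData W N) : congruenceNumber D.f ≠ 0 := fun h0 =>
  (Nat.pos_iff_ne_zero.mp D.prod_heckeCongruenceModulus_pos)
    (Nat.eq_zero_of_zero_dvd (h0 ▸ D.congruenceNumber_dvd_prod_heckeCongruenceModulus))

/-- Optimal data exist: among all data (of all elliptic `W'`) with the newform of `D`, one has least degree —
well-foundedness of `ℕ` (copy of k2 g5 `exists_optimalDatum`). [folklore] -/
theorem exists_optimalDatum {W : WeierstrassCurve ℚ} [W.IsElliptic] {N : ℕ} [NeZero N]
    (D : ModularParametrizationData W N) :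
    ∃ (W₀ : WeierstrassCurve ℚ) (_ : W₀.IsElliptic) (D₀ : ModularParametrizationData W₀ N),
      D₀.f = D.f ∧ ∀ (W' : WeierstrassCurve ℚ) [W'.IsElliptic] (D' : ModularParametrizationData W' N),
        D'.f = D₀.f → D₀.modularDegree ≤ D'.modularDegree := by
  classical
  let S : Set ℕ := {m | ∃ (W' : WeierstrassCurve ℚ) (_ : W'.IsElliptic)
      (D' : ModularParametrizationData W' N), D'.f = D.f ∧ D'.modularDegree = m}
  have hne : S.Nonempty := ⟨D.modularDegree, W, ‹_›, D, rfl, rfl⟩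
  obtain ⟨W₀, i₀, D₀, hf, hm⟩ := Nat.sInf_mem hne
  refine ⟨W₀, i₀, D₀, hf, fun W' _ D' hD' => ?_⟩
  rw [hm]
  exact Nat.sInf_le ⟨W', ‹_›, D', hD'.trans hf, rfl⟩

/-! ## 1 · The statements -/

/-- The registered stub `P6TamagawaSplit.stub_primeToSixDegreeBound`, verbatim. -/
def Stub : Prop :=
  ∀ ε : ℝ, 0 < ε → ∃ C : ℝ, ∀ a b : ℤ, IsCoprime a b → a * b * (a + b) ≠ 0 → ∀ (N : ℕ) [NeZero N],
    (Literature.NumberTheory.EllipticCurves.freyCurve a b).conductorNorm ℤ = N →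
    ∀ D : Literature.NumberTheory.EllipticCurves.ModularForms.ModularParametrizationData
      (Literature.NumberTheory.EllipticCurves.freyCurve a b) N,
      (∀ D' : Literature.NumberTheory.EllipticCurves.ModularForms.ModularParametrizationData
        (Literature.NumberTheory.EllipticCurves.freyCurve a b) N, D.deg ≤ D'.deg) →
      ((D.deg / (ordProj[2] D.deg * ordProj[3] D.deg) : ℕ) : ℝ) ≤ C * (N : ℝ) ^ (2 + ε)

/-- **Child 2♮ — `CongruenceNumberBound`** (k1 g11 certificate :2543, verbatim; = k2 g5 `CpsCongruenceBound`):
the prime-to-6 part of the congruence number of the Frey newform is `≤ C_ε N^(2+ε)`.  Data-free, guard-free. -/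
def CongruenceNumberBound : Prop :=
  ∀ ε : ℝ, 0 < ε → ∃ C : ℝ, ∀ a b : ℤ, IsCoprime a b → a * b * (a + b) ≠ 0 → ∀ (N : ℕ) [NeZero N],
    (freyCurve a b).conductorNorm ℤ = N →
    ∀ f : CuspForm (Gamma0 N) 2, IsNewformOf (freyCurve a b) f →
      ((congruenceNumber f / (ordProj[2] (congruenceNumber f) * ordProj[3] (congruenceNumber f)) : ℕ) : ℝ) ≤
        C * (N : ℝ) ^ (2 + ε)

/-- The same statement over parametrisation data (the shape the registered glue p137293 quantifies over). -/
def CongruenceNumberBoundDatum : Prop :=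
  ∀ ε : ℝ, 0 < ε → ∃ C : ℝ, ∀ a b : ℤ, IsCoprime a b → a * b * (a + b) ≠ 0 → ∀ (N : ℕ) [NeZero N],
    (freyCurve a b).conductorNorm ℤ = N →
    ∀ D : ModularParametrizationData (freyCurve a b) N,
      ((congruenceNumber D.f / (ordProj[2] (congruenceNumber D.f) * ordProj[3] (congruenceNumber D.f)) : ℕ) : ℝ) ≤
        C * (N : ℝ) ^ (2 + ε)

/-- **H5 — one-sided ARS** (k1 g15 Sketch :40, verbatim): `p ≥ 5`, `p² ∤ N`, `D` minimal among data with the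
same newform ⇒ `ord_p r_{D.f} ≤ ord_p deg D`.  Implied by the tree's two-sided named fact
`padicValNat_congruenceNumber_eq_of_not_sq_dvd` (k1 g15 `oneSidedARS_of_ARS`).
[cite: AgasheRibetStein2012, Thm. 2.1(b), Prop. 5.4–5.10] -/
def OneSidedARS : Prop :=
  ∀ (W : WeierstrassCurve ℚ) [W.IsElliptic] (N : ℕ) [NeZero N] (D : ModularParametrizationData W N),
    (∀ (W' : WeierstrassCurve ℚ) [W'.IsElliptic] (D' : ModularParametrizationData W' N),
        D'.f = D.f → D.modularDegree ≤ D'.modularDegree) →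
      ∀ p : ℕ, p.Prime → 5 ≤ p → ¬ p ^ 2 ∣ N →
        padicValNat p (congruenceNumber D.f) ≤ padicValNat p D.modularDegree

/-- The tree's named fact (ARS Thm 2.1(b), equality form) implies H5 (copy of k1 g15). [cite: AgasheRibetStein2012, Thm. 2.1(b)] -/
theorem oneSidedARS_of_ARS (h : padicValNat_congruenceNumber_eq_of_not_sq_dvd) : OneSidedARS :=
  fun W _ N _ D hmin p hp _ hsq => (h W N D hmin p hp hsq).le

/-- **Optimal/Kenku transport** (k2 g5 `FreyCpsTransport`, verbatim): a least-degree parametrisation of the model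
`E_(a,b)` factors through the optimal quotient and a cyclic isogeny of Kenku degree `≤ 163`, so
`cps(deg) ≤ 163 · cps(deg_optimal)`.  KNOWN IN PRINT (Mazur 1978, Kenku 1982; Pasten–Shimura 2024 §3); route
items `MazurKenkuBound` / `IsogenyValuationTransport`. [cite: Kenku1982] -/
def FreyCpsTransport : Prop :=
  ∀ a b : ℤ, IsCoprime a b → a * b * (a + b) ≠ 0 →
    ∀ (N : ℕ) [NeZero N], (freyCurve a b).conductorNorm ℤ = N →
    ∀ D : ModularParametrizationData (freyCurve a b) N,
      (∀ D' : ModularParametrizationData (freyCurve a b) N, D.deg ≤ D'.deg) →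
      ∀ (W₀ : WeierstrassCurve ℚ) [W₀.IsElliptic] (D₀ : ModularParametrizationData W₀ N), D₀.f = D.f →
        (∀ (W' : WeierstrassCurve ℚ) [W'.IsElliptic] (D' : ModularParametrizationData W' N),
            D'.f = D₀.f → D₀.modularDegree ≤ D'.modularDegree) →
        cps D.deg ≤ 163 * cps D₀.modularDegree

/-! ## 2 · Q1 — quantifier surgery (PROVED): the newform binder is a dummy -/

/-- Under `FreyModularity` the newform form and the datum form of child 2♮ coincide: `→` instantiates at
`f := D.f`; `←` takes any datum `D` (modularity) and uses uniqueness of the newform of `E_(a,b)`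
(`IsNewformOf.unique`, the `q`-expansion principle) to get `D.f = f`.  Contrast: the registered P6 needs the
second-order guard `∀ D', D.deg ≤ D'.deg` (load-bearing, p162897) because `deg` is an invariant of the datum
only up to the `[m]∘φ` fibre, while `r_f` is an invariant of the isogeny class. [folklore] -/
theorem congruenceNumberBound_iff_datum (hMod : Summit.ABC.ABC.Theses.DefiniteXi.FreyModularity) :
    CongruenceNumberBound ↔ CongruenceNumberBoundDatum := by
  constructor
  · intro h ε hε
    obtain ⟨C, hC⟩ := h ε hε
    exact ⟨C, fun a b hab h0 N _ hN D => hC a b hab h0 N hN D.f D.isNewformOf⟩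
  · intro h ε hε
    obtain ⟨C, hC⟩ := h ε hε
    refine ⟨C, fun a b hab h0 N _ hN f hf => ?_⟩
    obtain ⟨D⟩ := hMod a b hab h0 N hN
    have hDf : D.f = f := D.isNewformOf.unique hf
    rw [← hDf]
    exact hC a b hab h0 N hN D

/-! ## 3 · P4 — the `0 < ε` guard in the new currency (PROVED; port of p163062) -/

/-- **`0 < ε` is load-bearing in child 2♮ as well.**  Granting `FreyModularity` and the unboundedness of Frey
conductors (`hUnb` := `FreyDegreeBound.Negative.conductorNorm_freyCurve_unbounded`, PROVED in the tree:
`p ≤ 2 N(E_(1,p))`), the statement with `0 < ε` dropped is false: `ε = −3`, a Frey curve of conductor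
`N > max C 0`, a datum `D` on it, `f := D.f`; then `1 ≤ cps r_f ≤ C · N^(2−3) = C/N < 1`. [folklore] -/
theorem congruenceNumberBound_false_without_eps_pos
    (hMod : Summit.ABC.ABC.Theses.DefiniteXi.FreyModularity)
    (hUnb : ∀ M : ℕ, ∃ a b : ℤ, IsCoprime a b ∧ a * b * (a + b) ≠ 0 ∧ M < (freyCurve a b).conductorNorm ℤ) :
    ¬ (∀ ε : ℝ, ∃ C : ℝ, ∀ a b : ℤ, IsCoprime a b → a * b * (a + b) ≠ 0 → ∀ (N : ℕ) [NeZero N],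
        (freyCurve a b).conductorNorm ℤ = N →
        ∀ f : CuspForm (Gamma0 N) 2, IsNewformOf (freyCurve a b) f →
          ((congruenceNumber f / (ordProj[2] (congruenceNumber f) * ordProj[3] (congruenceNumber f)) : ℕ) : ℝ) ≤
            C * (N : ℝ) ^ (2 + ε)) := by
  intro h
  obtain ⟨C, hC⟩ := h (-3)
  obtain ⟨a, b, hab, h0, hM⟩ := hUnb ⌈max C 0⌉₊
  haveI := isElliptic_freyCurve h0
  set N : ℕ := (freyCurve a b).conductorNorm ℤ with hN
  haveI : NeZero N := ⟨((freyCurve a b).conductorNorm_pos_holds).ne'⟩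
  obtain ⟨D⟩ := hMod a b hab h0 N rfl
  have hle := hC a b hab h0 N rfl D.f D.isNewformOf
  have h1 : (1 : ℝ) ≤ ((congruenceNumber D.f / (ordProj[2] (congruenceNumber D.f) *
      ordProj[3] (congruenceNumber D.f)) : ℕ) : ℝ) := by
    exact_mod_cast one_le_primeToSix_of_ne_zero (congruenceNumber_ne_zero_of_datum D)
  have hNpos : (0 : ℝ) < (N : ℝ) := by exact_mod_cast Nat.pos_of_ne_zero (NeZero.ne N)
  have hrpow : (N : ℝ) ^ ((2 : ℝ) + -3) = (N : ℝ)⁻¹ := by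
    rw [show (2 : ℝ) + -3 = -1 by norm_num, Real.rpow_neg_one]
  rw [hrpow] at hle
  have hN0' : max C 0 < (N : ℝ) := by
    have h2 : ⌈max C 0⌉₊ < N := hM
    exact_mod_cast Nat.lt_of_ceil_lt h2
  have hlt : C * (N : ℝ)⁻¹ < 1 :=
    calc C * (N : ℝ)⁻¹ ≤ max C 0 * (N : ℝ)⁻¹ :=
          mul_le_mul_of_nonneg_right (le_max_left _ _) (inv_nonneg.mpr hNpos.le)
      _ < (N : ℝ) * (N : ℝ)⁻¹ := mul_lt_mul_of_pos_right hN0' (inv_pos.mpr hNpos)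
      _ = 1 := mul_inv_cancel₀ hNpos.ne'
  exact (not_le.mpr hlt) (h1.trans hle)

/-! ## 4 · L6′ one-sided (copy of k1 g15): `cps r_{D.f} ≤ cps deg D` for EVERY datum of the Frey curve -/

/-- **L6′ from the ONE-SIDED input H5** (k1 g15 `primeToSix_congruenceNumber_le_primeToSix_deg_of_oneSided`,
copied): for the Frey curve and ANY datum `D` at its conductor, `cps(r_{D.f}) ≤ cps(deg D)`.  Route: optimal datum
`D₀` with `D₀.f = D.f` (`exists_optimalDatum'`, injective isogeny map ⇒ minimal in its newform class and
`deg D₀ ∣ deg D`), H5 at every `p ≥ 5` (`p² ∤ N_Frey`), valuation bookkeeping. [cite: AgasheRibetStein2012, Thm. 2.1(b)] -/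
theorem primeToSix_congruenceNumber_le_primeToSix_deg_of_oneSided (hARS : OneSidedARS)
    {a b : ℤ} (hab : IsCoprime a b) (h0 : a * b * (a + b) ≠ 0) {N : ℕ} [NeZero N]
    (hN : (freyCurve a b).conductorNorm ℤ = N) (D : ModularParametrizationData (freyCurve a b) N) :
    congruenceNumber D.f / (ordProj[2] (congruenceNumber D.f) * ordProj[3] (congruenceNumber D.f)) ≤
      D.deg / (ordProj[2] D.deg * ordProj[3] D.deg) := by
  haveI := isElliptic_freyCurve h0
  obtain ⟨W₀, hW₀, D₀, hf₀, h₀⟩ := D.exists_optimalDatum'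
  haveI := hW₀
  have hker₀ : D₀.isogenyMap.ker = ⊥ := D₀.isogenyMap_ker_eq_bot_iff.mpr h₀
  have hmin₀ : ∀ (W₂ : WeierstrassCurve ℚ) [W₂.IsElliptic] (D₂ : ModularParametrizationData W₂ N),
      D₂.f = D₀.f → D₀.modularDegree ≤ D₂.modularDegree := fun W₂ _ D₂ hD₂ =>
    D₀.modularDegree_le_of_isogenyMap_ker_eq_bot hker₀ D₂ hD₂
  have hdvd : D₀.modularDegree ∣ D.deg := by
    have hinj : Function.Injective D₀.isogenyMap := (AddMonoidHom.ker_eq_bot_iff _).mp hker₀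
    obtain ⟨_, hdeg⟩ := D.modularDegree_eq_card_ker_mul hf₀.symm D₀.smul_periodLattice_le hinj
      D₀.deg_pos D₀.finite_setOf_natCard_fiberOrbits_ne
    exact ⟨_, hdeg.trans (mul_comm _ _)⟩
  have hd0 : D₀.modularDegree ≠ 0 := D₀.deg_pos.ne'
  have hval : ∀ p : ℕ, p.Prime → 5 ≤ p → (congruenceNumber D.f).factorization p ≤
      D₀.modularDegree.factorization p + (1 : ℕ).factorization p := by
    intro p hp h5
    have hsq : ¬ p ^ 2 ∣ N := by
      have h := not_sq_dvd_conductorNorm_freyCurve_of_ne_two hab h0 hp (by omega)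
      rwa [hN] at h
    have h := hARS W₀ N D₀ hmin₀ p hp h5 hsq
    rw [hf₀, ← Nat.factorization_def _ hp, ← Nat.factorization_def _ hp] at h
    simpa using h
  calc congruenceNumber D.f / (ordProj[2] (congruenceNumber D.f) * ordProj[3] (congruenceNumber D.f))
      ≤ D₀.modularDegree / (ordProj[2] D₀.modularDegree * ordProj[3] D₀.modularDegree) * 1 :=
        primeToSix_le_mul_of_factorization_le hd0 one_ne_zero hval
    _ = D₀.modularDegree / (ordProj[2] D₀.modularDegree * ordProj[3] D₀.modularDegree) := mul_one _
    _ ≤ D.deg / (ordProj[2] D.deg * ordProj[3] D.deg) := primeToSix_le_of_dvd' hdvd D.deg_pos.ne'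

/-! ## 5 · P1′ / P1 / P3 (PROVED) and P2 (statement) — the calibration square in congruence currency -/

/-- **P1′ — H0 in the new currency (PROVED from H5).**  `FreyDegreeBound → CongruenceNumberBound`: the datum `D`
with `deg D ≤ C N^(2+ε)` given by `FreyDegreeBound` need NOT be minimal (L6′ holds for every datum), `D.f = f`
by uniqueness, and `cps r_f ≤ cps deg D ≤ deg D`.  In degree currency H0 is hypothesis-free (p162616); here it
costs exactly H5 — the XL input moves from child 1 of the split to this (non-deciding) calibration edge.
[cite: AgasheRibetStein2012, Thm. 2.1(b)] -/
theorem congruenceNumberBound_of_freyDegreeBound (hARS : OneSidedARS)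
    (hX : Summit.ABC.ABC.Theses.DefiniteXi.FreyDegreeBound) : CongruenceNumberBound := by
  intro ε hε
  obtain ⟨C, hC⟩ := hX ε hε
  refine ⟨C, fun a b hab h0 N _ hN f hf => ?_⟩
  obtain ⟨D, hD⟩ := hC a b hab h0 N hN
  have hDf : D.f = f := D.isNewformOf.unique hf
  rw [← hDf]
  have h1 := primeToSix_congruenceNumber_le_primeToSix_deg_of_oneSided hARS hab h0 hN D
  have h2 : D.deg / (ordProj[2] D.deg * ordProj[3] D.deg) ≤ D.deg := Nat.div_le_self _ _
  calc ((congruenceNumber D.f / (ordProj[2] (congruenceNumber D.f) * ordProj[3] (congruenceNumber D.f)) : ℕ) : ℝ)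
      ≤ (D.deg : ℝ) := by exact_mod_cast h1.trans h2
    _ ≤ C * (N : ℝ) ^ (2 + ε) := hD

/-- **P1 (PROVED from H5 + `FreyModularity`).**  `Stub → CongruenceNumberBound`: given `f`, a minimal datum `D`
(`exists_minimal_datum`), `D.f = f` (`IsNewformOf.unique`), `cps r_{D.f} ≤ cps deg D` (L6′ one-sided), then the stub
at `D`.  [cite: AgasheRibetStein2012, Thm. 2.1(b)] -/
theorem congruenceNumberBound_of_stub (hARS : OneSidedARS)
    (hMod : Summit.ABC.ABC.Theses.DefiniteXi.FreyModularity) (h : Stub) : CongruenceNumberBound := by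
  intro ε hε
  obtain ⟨C, hC⟩ := h ε hε
  refine ⟨C, fun a b hab h0 N _ hN f hf => ?_⟩
  obtain ⟨D, -, hmin⟩ := exists_minimal_datum (hMod a b hab h0 N hN)
  have hDf : D.f = f := D.isNewformOf.unique hf
  rw [← hDf]
  have h1 := primeToSix_congruenceNumber_le_primeToSix_deg_of_oneSided hARS hab h0 hN D
  have h2 := hC a b hab h0 N hN D hmin
  calc ((congruenceNumber D.f / (ordProj[2] (congruenceNumber D.f) * ordProj[3] (congruenceNumber D.f)) : ℕ) : ℝ)
      ≤ ((D.deg / (ordProj[2] D.deg * ordProj[3] D.deg) : ℕ) : ℝ) := by exact_mod_cast h1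
    _ ≤ C * (N : ℝ) ^ (2 + ε) := h2

/-- **P3 (PROVED modulo Ribet + transport; = k2 g5 H8a).**  The registered stub back from child 2♮: optimal datum `D₀`
with `D₀.f = D.f` (`exists_optimalDatum`, well-ordering), `cps deg D ≤ 163 cps deg D₀` (transport), `deg D₀ ∣ r_f`
(Ribet, `modularDegree_dvd_congruenceNumber`, UNPROVED named fact), child 2♮ at `f := D.f`.
[cite: AgasheRibetStein2012, Thm. 2.1(a)] [cite: Kenku1982] -/
theorem stub_of_congruenceNumberBound (hR : modularDegree_dvd_congruenceNumber) (hT : FreyCpsTransport)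
    (h : CongruenceNumberBound) : Stub := by
  intro ε hε
  obtain ⟨C, hC⟩ := h ε hε
  refine ⟨163 * C, ?_⟩
  intro a b hab h0 N _ hN D hmin
  haveI := isElliptic_freyCurve h0
  obtain ⟨W₀, i₀, D₀, hf, hopt⟩ := exists_optimalDatum D
  have h1 : cps D.deg ≤ 163 * cps D₀.modularDegree := hT a b hab h0 N hN D hmin W₀ D₀ hf hopt
  have h2 : D₀.modularDegree ∣ congruenceNumber D₀.f := hR W₀ N D₀ hopt
  have h3 : cps D₀.modularDegree ≤ cps (congruenceNumber D.f) :=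
    hf ▸ primeToSix_le_of_dvd' h2 (congruenceNumber_ne_zero_of_datum D₀)
  have h4 : ((cps (congruenceNumber D.f) : ℕ) : ℝ) ≤ C * (N : ℝ) ^ (2 + ε) :=
    hC a b hab h0 N hN D.f D.isNewformOf
  show ((cps D.deg : ℕ) : ℝ) ≤ 163 * C * (N : ℝ) ^ (2 + ε)
  have h13 : ((cps D.deg : ℕ) : ℝ) ≤ 163 * ((cps (congruenceNumber D.f) : ℕ) : ℝ) := by
    exact_mod_cast h1.trans (Nat.mul_le_mul_left 163 h3)
  nlinarith [h13, h4]

/-- **P2 (XS after P1′ + G4; statement only — G4 lives in the non-importable helper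
`STUB_PLAN_stub_primeToSixDegreeBound_P6Ladder3.lean`, rc 0, not yet landed).**  `ABC → CongruenceNumberBound` modulo
FOUR named facts: `congruenceNumberBound_of_freyDegreeBound hARS (SteinbergCoreP6Ladder.freyDegreeBound_of_ABC_of_facts
hmod h102 hMK h)`. [cite: MurtyCongruencePrimes1999, Thm 1] [cite: PastenShimura2024, Cor. 10.2] [cite: AgasheRibetStein2012, Thm. 2.1] -/
theorem congruenceNumberBound_of_ABC_of_facts (hmod : exists_isNewformOf) (h102 : PastenShimura2024_cor_10_2)
    (hMK : mazurKenku_exists_cyclic_isogeny) (hARS : OneSidedARS) (h : _root_.ABC) : CongruenceNumberBound := by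
  sorry

end Summit.ABC.ABC.Cruxes.SteinbergCore.StubIdeas2G19

end
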